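import Literature.MathematicalPhysics.QuantumLattice.SchwartzTensor
import Literature.Analysis.Distribution.ScaledKernelPairing
import Literature.Analysis.FunctionSpaces.TranslationInvariantDistribution
import Mathlib.Analysis.SpecialFunctions.SmoothTransition
import Mathlib.Analysis.InnerProductSpace.Calculus
import Mathlib.Analysis.Normed.Lp.MeasurableSpace
import HarnessLib

/-!
# Radial approximate identity and the regularisation step (stub `stub_locality`, helper)

Helper file for stub `stub_locality` of line `Sketch` (crux `OSLegsAtWeakCouplingC`, stmt-QuantumFields-16207):
`theorem exists_radial_approxIdentity_eq_zero`.  It supplies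

1. a family `ρ δ ∈ 𝓢(ℝ⁴, ℂ)` (`δ > 0`) of **radial, real, smooth bumps supported in the closed `δ`-ball**:
   `ρ δ = (ρ₁)_δ` is the scaled kernel (`Literature.Analysis.Distribution.scaleKernel`, `N_w(y) = w^{-4} N(y/w)`) of the
   unit profile `ρ₁(x) = smoothTransition (1 - ‖x‖²)` (a function of `‖x‖`, hence invariant under every linear isometry
   of `ℝ⁴`; `Real.smoothTransition` vanishes on `(-∞, 0]`, so `ρ₁ = 0` off the open unit ball);
2. the **regularisation argument**: if a tempered distribution `G` on `(ℝ⁴)ⁿ` kills every product bump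
   `⊗ᵢ ρ_δ(· − yᵢ)` with centre configuration `y` in a set `V` and width `δ < δ₀`, then `G F = 0` for every Schwartz `F`
   with `tsupport F ⊆ V`.  Proof: transport to the Euclidean model `W = ℓ²(Fin n, ℝ⁴)` of `(ℝ⁴)ⁿ` (the tree's averaging
   operators live on inner product spaces); the product kernel `K(y) = ∏ᵢ ρ₁(yᵢ)`, normalised to mass one, is a compactly
   supported kernel `N`, its scalings `N_w` are an approximate identity (`tendsto_apply_translationAverage_scaleKernel`,
   Hörmander I §1.3 / §4.1: `u ∗ φ_ε → u` in `𝒮`), so `G(F) = lim_{w → 0⁺} G(N_w ∗ F)`; and by the exchange lemma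
   (`apply_translationAverage_eq_integral`, commutativity `translationAverage_id_comm`)
   `G(N_w ∗ F) = ∫ F(y) G(N_w(· − y)) dy = 0`, because `N_w(· − y)` is a scalar multiple of the product bump of width `w`
   centred at `y`, killed by `G` when `y ∈ V`, while `F(y) = 0` when `y ∉ V`.

No definitions are introduced (the profile is packaged by an existence statement).

Refs: L. Hörmander, *The Analysis of Linear Partial Differential Operators I* (1983), §1.3–§1.4 (cutoffs, regularisation
`u ∗ φ_ε → u`), Thm. 4.1.4; OsterwalderSchraderCMP1975 Ch. VI.1 (regularised Schwinger functions).
-/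

noncomputable section

open scoped SchwartzMap ContDiff ComplexConjugate BigOperators
open MeasureTheory Filter Set
open _root_.Topology
open Literature.Analysis.FunctionSpaces Literature.Analysis.FunctionSpaces.SchwartzAverage
open Literature.Analysis.Distribution

namespace Summit.QuantumFields.YangMills.Cruxes.OSLegsAtWeakCouplingC.Sketch

/-! ### The radial unit profile -/

/-- **A radial real smooth bump of the unit ball of `ℝ⁴`, as a Schwartz function.**  There is a Schwartz function
`ρ₁ = g` (real values cast to `ℂ`) with `g` continuous, `0 ≤ g`, `g 0 = 1`, `tsupport ρ₁ ⊆ B̄(0, 1)`, and `g ∘ P = g`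
for every linear isometry `P` of `ℝ⁴`; namely `g(x) = smoothTransition (1 - ‖x‖²)` (Hörmander I, §1.4, the standard
cutoff construction; here via Mathlib's `Real.smoothTransition` and `HasCompactSupport.toSchwartzMap`). -/
theorem exists_radial_unitBump_schwartz :
    ∃ (g : EuclideanSpace ℝ (Fin 4) → ℝ) (ρ₁ : 𝓢(EuclideanSpace ℝ (Fin 4), ℂ)),
      (∀ x, ρ₁ x = (g x : ℂ)) ∧ Continuous g ∧ (∀ x, 0 ≤ g x) ∧ g 0 = 1 ∧
      tsupport (ρ₁ : EuclideanSpace ℝ (Fin 4) → ℂ) ⊆ Metric.closedBall 0 1 ∧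
      ∀ (P : EuclideanSpace ℝ (Fin 4) ≃ₗᵢ[ℝ] EuclideanSpace ℝ (Fin 4)) (x : EuclideanSpace ℝ (Fin 4)),
        g (P x) = g x := by
  set g : EuclideanSpace ℝ (Fin 4) → ℝ := fun x => Real.smoothTransition (1 - ‖x‖ ^ 2) with hg
  have hg_smooth : ContDiff ℝ ∞ g :=
    Real.smoothTransition.contDiff.comp (contDiff_const.sub (contDiff_norm_sq ℝ))
  have hg_zero : ∀ x : EuclideanSpace ℝ (Fin 4), 1 ≤ ‖x‖ → g x = 0 := fun x hx =>
    Real.smoothTransition.zero_of_nonpos (by nlinarith [norm_nonneg x])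
  set f : EuclideanSpace ℝ (Fin 4) → ℂ := fun x => (g x : ℂ) with hf
  have hf_smooth : ContDiff ℝ ∞ f := Complex.ofRealCLM.contDiff.comp hg_smooth
  have hf_zero : ∀ x : EuclideanSpace ℝ (Fin 4), 1 < ‖x‖ → f x = 0 := fun x hx => by
    simp only [hf, hg_zero x hx.le, Complex.ofReal_zero]
  have hf_supp : HasCompactSupport f := by
    refine HasCompactSupport.of_support_subset_isCompact (isCompact_closedBall (0 : EuclideanSpace ℝ (Fin 4)) 1)
      fun x hx => ?_
    rw [Metric.mem_closedBall, dist_zero_right]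
    by_contra h
    exact hx (hf_zero x (not_le.1 h))
  refine ⟨g, hf_supp.toSchwartzMap hf_smooth, fun x => rfl, hg_smooth.continuous,
    fun x => Real.smoothTransition.nonneg _, ?_, ?_, ?_⟩
  · simp [hg, Real.smoothTransition.one]
  · refine closure_minimal (fun x hx => ?_) Metric.isClosed_closedBall
    rw [Metric.mem_closedBall, dist_zero_right]
    by_contra h
    exact hx (hf_zero x (not_le.1 h))
  · intro P x
    simp [hg]

/-! ### Approximate identity ⇒ vanishing -/

/-- **Regularisation removes itself**: on a finite-dimensional real inner product space, if `N` is a Schwartz kernel of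
compact support and mass one and a tempered distribution `T` satisfies `u(y) · T(N_w(· − y)) = 0` for all `y` and all
scales `0 < w < δ₀`, then `T u = 0`.  Indeed `T(N_w ∗ u) = ∫ u(y) T(N_w(· − y)) dy = 0` (exchange lemma and
commutativity of convolution) while `N_w ∗ u → u` in `𝒮` as `w → 0⁺` (Hörmander I, Thm. 4.1.4 / §1.3:
`u ∗ φ_ε → u`; tree: `tendsto_apply_translationAverage_scaleKernel`). -/
theorem apply_eq_zero_of_mul_apply_translate_scaleKernel_eq_zero {W : Type*} [NormedAddCommGroup W]
    [InnerProductSpace ℝ W] [FiniteDimensional ℝ W] [MeasurableSpace W] [BorelSpace W]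
    (T : 𝓢(W, ℂ) →L[ℂ] ℂ) (N u : 𝓢(W, ℂ)) {R : ℝ} (hN : tsupport (N : W → ℂ) ⊆ Metric.closedBall 0 R)
    (hmass : ∫ y, N y = 1) {δ₀ : ℝ} (hδ₀ : 0 < δ₀)
    (h : ∀ w : ℝ, 0 < w → w < δ₀ → ∀ y : W, u y * T (SchwartzMap.compSubConstCLM ℂ y (scaleKernel w N)) = 0) :
    T u = 0 := by
  have hlim := tendsto_apply_translationAverage_scaleKernel T N u hN hmass
  have hev : (fun w : ℝ => T (translationAverage (ContinuousLinearMap.id ℝ W) (scaleKernel w N) u))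
      =ᶠ[𝓝[>] (0 : ℝ)] fun _ => (0 : ℂ) := by
    filter_upwards [Ioo_mem_nhdsGT hδ₀] with w hw
    rw [translationAverage_id_comm, apply_translationAverage_eq_integral]
    have hzero : (fun y : W => u y * T (SchwartzMap.compSubConstCLM ℂ y (scaleKernel w N))) = fun _ => 0 :=
      funext (h w hw.1 hw.2)
    rw [hzero, integral_zero]
  exact tendsto_nhds_unique hlim (tendsto_const_nhds.congr' hev.symm)

/-! ### The regularisation argument, transported to a Euclidean model of `(ℝ⁴)ⁿ` -/

/-- **Vanishing on product bumps implies vanishing** (the regularisation step of the locality argument).  Let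
`e : W ≃L (Fin n → ℝ⁴)` be a Euclidean model of the configuration space, `ρ₁ = g ≥ 0` a profile with `g 0 = 1`
supported in the closed unit ball, and `G` a tempered distribution on `(ℝ⁴)ⁿ` with
`G(⊗ᵢ (ρ₁)_δ(· − yᵢ)) = 0` for all centres `y ∈ V` and widths `0 < δ < δ₀`.  Then `G F = 0` whenever
`tsupport F ⊆ V`: the translate `N_w(· − y)` of the normalised scaled product kernel `N = (∫K)⁻¹ K`, `K(y) = ∏ᵢ ρ₁(yᵢ)`,
is a scalar multiple of the product bump of width `w` centred at `e y`, so the integrand of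
`G(N_w ∗ F) = ∫ F(e y) G(N_w(· − y)) dy` vanishes identically, and `N_w ∗ F → F` in `𝒮`
(Hörmander I, Thm. 4.1.4; OS II, Ch. VI.1). -/
theorem apply_eq_zero_of_prodBump_translates_eq_zero {n : ℕ} {W : Type*} [NormedAddCommGroup W]
    [InnerProductSpace ℝ W] [FiniteDimensional ℝ W] [MeasurableSpace W] [BorelSpace W]
    (e : W ≃L[ℝ] (Fin n → EuclideanSpace ℝ (Fin 4)))
    {g : EuclideanSpace ℝ (Fin 4) → ℝ} {ρ₁ : 𝓢(EuclideanSpace ℝ (Fin 4), ℂ)}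
    (hρg : ∀ x, ρ₁ x = (g x : ℂ)) (hgc : Continuous g) (hg0 : ∀ x, 0 ≤ g x) (hg1 : g 0 = 1)
    (hρsupp : tsupport (ρ₁ : EuclideanSpace ℝ (Fin 4) → ℂ) ⊆ Metric.closedBall 0 1)
    (G : 𝓢((Fin n → EuclideanSpace ℝ (Fin 4)), ℂ) →L[ℂ] ℂ) (V : Set (Fin n → EuclideanSpace ℝ (Fin 4)))
    {δ₀ : ℝ} (hδ₀ : 0 < δ₀)
    (hG : ∀ δ : ℝ, 0 < δ → δ < δ₀ → ∀ y ∈ V,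
      G (SchwartzMap.tensorFin n (fun i => SchwartzMap.compSubConstCLM ℂ (y i) (scaleKernel δ ρ₁))) = 0)
    (F : 𝓢((Fin n → EuclideanSpace ℝ (Fin 4)), ℂ))
    (hFV : tsupport (F : (Fin n → EuclideanSpace ℝ (Fin 4)) → ℂ) ⊆ V) : G F = 0 := by
  -- the transported functional, test function and product kernel
  set G' : 𝓢(W, ℂ) →L[ℂ] ℂ := G.comp (SchwartzMap.compCLMOfContinuousLinearEquiv ℂ e.symm) with hG'
  set F' : 𝓢(W, ℂ) := SchwartzMap.compCLMOfContinuousLinearEquiv ℂ e F with hF'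
  set N₀ : 𝓢(W, ℂ) := SchwartzMap.compCLMOfContinuousLinearEquiv ℂ e (SchwartzMap.tensorFin n fun _ => ρ₁)
    with hN₀
  have hN₀_apply : ∀ y : W, N₀ y = ∏ i, ρ₁ (e y i) := fun y => by
    simp [hN₀, SchwartzMap.tensorFin_apply]
  have hGF : G F = G' F' := by
    simp only [hG', hF', ContinuousLinearMap.comp_apply]
    congr 1
    ext x
    simp
  -- far out, some coordinate leaves the unit ball, so the product kernel vanishes
  obtain ⟨R, hfar⟩ : ∃ R : ℝ, ∀ y : W, R < ‖y‖ → ∃ i, 1 < ‖e y i‖ := by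
    refine ⟨‖(e.symm : (Fin n → EuclideanSpace ℝ (Fin 4)) →L[ℝ] W)‖, fun y hy => ?_⟩
    by_contra hcon
    have h1 : ‖e y‖ ≤ 1 := (pi_norm_le_iff_of_nonneg zero_le_one).2 fun i => not_lt.1 fun hi => hcon ⟨i, hi⟩
    have h2 : ‖y‖ ≤ ‖(e.symm : (Fin n → EuclideanSpace ℝ (Fin 4)) →L[ℝ] W)‖ * ‖e y‖ := by
      simpa using (e.symm : (Fin n → EuclideanSpace ℝ (Fin 4)) →L[ℝ] W).le_opNorm (e y)
    have h3 := h2.trans (mul_le_of_le_one_right (norm_nonneg _) h1)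
    linarith
  have hN₀_zero : ∀ y : W, R < ‖y‖ → N₀ y = 0 := fun y hy => by
    obtain ⟨i, hi⟩ := hfar y hy
    rw [hN₀_apply]
    exact Finset.prod_eq_zero (Finset.mem_univ i) (eq_zero_of_tsupport_subset_closedBall hρsupp _ hi)
  -- the product kernel is (the complexification of) a nonnegative function, positive at the origin
  have hN₀_re : ∀ y : W, N₀ y = ((∏ i, g (e y i) : ℝ) : ℂ) := fun y => by
    rw [hN₀_apply, Complex.ofReal_prod]
    exact Finset.prod_congr rfl fun i _ => hρg _
  have hmass₀ : (∫ y, N₀ y) ≠ 0 := by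
    have hfun : (fun y : W => N₀ y) = fun y => ((∏ i, g (e y i) : ℝ) : ℂ) := funext hN₀_re
    rw [hfun, integral_complex_ofReal, Complex.ofReal_ne_zero]
    refine (Continuous.integral_pos_of_hasCompactSupport_nonneg_nonzero (μ := volume) (x := 0) ?_ ?_ ?_ ?_).ne'
    · exact continuous_finsetProd _ fun i _ => hgc.comp ((continuous_apply i).comp e.continuous)
    · refine HasCompactSupport.of_support_subset_isCompact (isCompact_closedBall (0 : W) R) fun y hy => ?_
      rw [Metric.mem_closedBall, dist_zero_right]
      by_contra hcon
      have hz := hN₀_zero y (not_le.1 hcon)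
      rw [hN₀_re, Complex.ofReal_eq_zero] at hz
      exact hy hz
    · exact fun y => Finset.prod_nonneg fun i _ => hg0 _
    · simp [hg1]
  -- the normalised kernel
  set c : ℂ := (∫ y, N₀ y)⁻¹ with hc
  set N : 𝓢(W, ℂ) := c • N₀ with hN
  have hN_apply : ∀ y : W, N y = c * N₀ y := fun y => rfl
  have hmass : ∫ y, N y = 1 := by
    simp only [hN_apply]
    rw [integral_const_mul, hc, inv_mul_cancel₀ hmass₀]
  have hNsupp : tsupport (N : W → ℂ) ⊆ Metric.closedBall 0 R := by
    refine closure_minimal (fun y hy => ?_) Metric.isClosed_closedBall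
    rw [Metric.mem_closedBall, dist_zero_right]
    by_contra hcon
    exact hy (by rw [hN_apply, hN₀_zero y (not_le.1 hcon), mul_zero])
  -- the regularisation argument on `W`
  rw [hGF]
  refine apply_eq_zero_of_mul_apply_translate_scaleKernel_eq_zero G' N F' hNsupp hmass hδ₀ fun w hw hwδ y => ?_
  by_cases hy : e y ∈ V
  · -- the pulled-back translate of `N_w` is a multiple of the product bump of width `w` centred at `e y`
    suffices hzero : G' (SchwartzMap.compSubConstCLM ℂ y (scaleKernel w N)) = 0 by rw [hzero, mul_zero]
    have ha : (((w ^ Module.finrank ℝ (EuclideanSpace ℝ (Fin 4)))⁻¹ : ℝ) : ℂ) ^ n ≠ 0 :=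
      pow_ne_zero _ (Complex.ofReal_ne_zero.2 (inv_ne_zero (pow_ne_zero _ hw.ne')))
    obtain ⟨C, hC⟩ : ∃ C : ℂ, C * (((w ^ Module.finrank ℝ (EuclideanSpace ℝ (Fin 4)))⁻¹ : ℝ) : ℂ) ^ n =
        (((w ^ Module.finrank ℝ W)⁻¹ : ℝ) : ℂ) * c :=
      ⟨(((w ^ Module.finrank ℝ W)⁻¹ : ℝ) : ℂ) * c *
          ((((w ^ Module.finrank ℝ (EuclideanSpace ℝ (Fin 4)))⁻¹ : ℝ) : ℂ) ^ n)⁻¹,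
        by rw [mul_assoc, inv_mul_cancel₀ ha, mul_one]⟩
    have hL : ∀ x : Fin n → EuclideanSpace ℝ (Fin 4),
        SchwartzMap.compCLMOfContinuousLinearEquiv ℂ e.symm (SchwartzMap.compSubConstCLM ℂ y (scaleKernel w N)) x =
          (((w ^ Module.finrank ℝ W)⁻¹ : ℝ) : ℂ) * c * ∏ i, ρ₁ (w⁻¹ • (x i - e y i)) := by
      intro x
      have hcoord : ∀ i, e (w⁻¹ • (e.symm x - y)) i = w⁻¹ • (x i - e y i) := fun i => by
        simp only [map_smul, map_sub, ContinuousLinearEquiv.apply_symm_apply, Pi.smul_apply, Pi.sub_apply]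
      simp only [SchwartzMap.compCLMOfContinuousLinearEquiv_apply, Function.comp_apply,
        SchwartzMap.compSubConstCLM_apply]
      rw [scaleKernel_apply hw.ne', hN_apply, hN₀_apply, Complex.real_smul,
        Finset.prod_congr rfl fun i _ => by rw [hcoord], mul_assoc]
    have hR : ∀ x : Fin n → EuclideanSpace ℝ (Fin 4),
        SchwartzMap.tensorFin n (fun i => SchwartzMap.compSubConstCLM ℂ (e y i) (scaleKernel w ρ₁)) x =
          (((w ^ Module.finrank ℝ (EuclideanSpace ℝ (Fin 4)))⁻¹ : ℝ) : ℂ) ^ n * ∏ i, ρ₁ (w⁻¹ • (x i - e y i)) := by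
      intro x
      rw [SchwartzMap.tensorFin_apply]
      simp only [SchwartzMap.compSubConstCLM_apply]
      simp_rw [scaleKernel_apply hw.ne', Complex.real_smul]
      rw [Finset.prod_mul_distrib, Finset.prod_const, Finset.card_univ, Fintype.card_fin]
    have key : SchwartzMap.compCLMOfContinuousLinearEquiv ℂ e.symm (SchwartzMap.compSubConstCLM ℂ y (scaleKernel w N)) =
        C • SchwartzMap.tensorFin n (fun i => SchwartzMap.compSubConstCLM ℂ (e y i) (scaleKernel w ρ₁)) := by
      ext x
      rw [smul_apply, smul_eq_mul, hL, hR, ← mul_assoc, hC]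
    rw [hG', ContinuousLinearMap.comp_apply, key, map_smul, hG w hw hwδ (e y) hy, smul_zero]
  · have hF'y : F' y = 0 := by
      simp only [hF', SchwartzMap.compCLMOfContinuousLinearEquiv_apply, Function.comp_apply]
      exact image_eq_zero_of_notMem_tsupport fun hmem => hy (hFV hmem)
    rw [hF'y, zero_mul]

/-! ### The registered helper -/

/-- **Radial approximate identity and regularisation** (helper of stub `stub_locality`).  There is a family
`ρ δ ∈ 𝓢(ℝ⁴, ℂ)` such that for `δ > 0` the bump `ρ δ` is supported in the closed `δ`-ball, invariant under every linear
isometry of `ℝ⁴` and real-valued, and such that a tempered distribution on `(ℝ⁴)ⁿ` that kills all product bumps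
`⊗ᵢ ρ_δ(· − yᵢ)` with centres `y` in an open set `V` and small width kills every (compactly supported) Schwartz function
with `tsupport ⊆ V` (Hörmander I, Thm. 4.1.4, regularisation `u ∗ φ_ε → u`; OS II, Ch. VI.1).  The family is
`ρ δ = (ρ₁)_δ`, the scaled radial unit profile of `exists_radial_unitBump_schwartz`. -/
theorem exists_radial_approxIdentity_eq_zero : ∃ ρ : ℝ → 𝓢(EuclideanSpace ℝ (Fin 4), ℂ), (∀ δ : ℝ, 0 < δ → tsupport (ρ δ : EuclideanSpace ℝ (Fin 4) → ℂ) ⊆ Metric.closedBall 0 δ ∧ (∀ (P : EuclideanSpace ℝ (Fin 4) ≃ₗᵢ[ℝ] EuclideanSpace ℝ (Fin 4)) (x : EuclideanSpace ℝ (Fin 4)), ρ δ (P x) = ρ δ x) ∧ (∀ x : EuclideanSpace ℝ (Fin 4), (starRingEnd ℂ) (ρ δ x) = ρ δ x)) ∧ ∀ (n : ℕ) (G : 𝓢((Fin n → EuclideanSpace ℝ (Fin 4)), ℂ) →L[ℂ] ℂ) (V : Set (Fin n → EuclideanSpace ℝ (Fin 4))), IsOpen V → ∀ δ₀ : ℝ,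 0 < δ₀ → (∀ δ : ℝ, 0 < δ → δ < δ₀ → ∀ y ∈ V, G (SchwartzMap.tensorFin n (fun i => SchwartzMap.compSubConstCLM ℂ (y i) (ρ δ))) = 0) → ∀ F : 𝓢((Fin n → EuclideanSpace ℝ (Fin 4)), ℂ), HasCompactSupport (F : (Fin n → EuclideanSpace ℝ (Fin 4)) → ℂ) → tsupport (F : (Fin n → EuclideanSpace ℝ (Fin 4)) → ℂ) ⊆ V → G F = 0 := by
  obtain ⟨g, ρ₁, hρg, hgc, hg0, hg1, hρsupp, hgP⟩ := exists_radial_unitBump_schwartz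
  refine ⟨fun δ => scaleKernel δ ρ₁, fun δ hδ => ⟨?_, ?_, ?_⟩, ?_⟩
  · simpa only [mul_one] using tsupport_scaleKernel_subset hδ hρsupp
  · intro P x
    show scaleKernel δ ρ₁ (P x) = scaleKernel δ ρ₁ x
    rw [scaleKernel_apply hδ.ne', scaleKernel_apply hδ.ne', ← P.map_smul, hρg, hρg, hgP]
  · intro x
    show (starRingEnd ℂ) (scaleKernel δ ρ₁ x) = scaleKernel δ ρ₁ x
    rw [scaleKernel_apply hδ.ne', hρg, Complex.real_smul, map_mul, Complex.conj_ofReal, Complex.conj_ofReal]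
  · intro n G V _ δ₀ hδ₀ hG F _ hFV
    exact apply_eq_zero_of_prodBump_translates_eq_zero
      (PiLp.continuousLinearEquiv 2 ℝ (fun _ : Fin n => EuclideanSpace ℝ (Fin 4))) hρg hgc hg0 hg1 hρsupp G V hδ₀
      hG F hFV

end Summit.QuantumFields.YangMills.Cruxes.OSLegsAtWeakCouplingC.Sketch

end
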